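import Literature.Geometry.Symplectic.SteinJConvexThreshold
import Literature.Topology.FourManifolds.CobordismMorseFunctions
import HarnessLib

/-!
# A compact Stein domain carries a `J`-convex Morse function adapted to the boundary

Topic `Literature/Geometry/Symplectic`; second brick of the discharge of the named fact
`Literature.Geometry.Symplectic.Gompf1998_thm13_indexLE_two` (`SteinHandlebodies.lean`;
Gompf 1998, Thm. 1.3 (Eliashberg 1990), compact case, "only if", condition (a)).  Gompf (1998),
Thm. 1.3, as printed: *"In either case, any such handle decomposition comes from a strictly
plurisubharmonic function (with `∂X` a level set)"*; the step isolated here is the classical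
remark that **the `J`-convex defining function of a Stein domain may be assumed Morse**
(Eliashberg 1990, §1; Cieliebak–Eliashberg 2012, §2.1 and Ch. 8: `J`-convexity is a `C²`-open
condition, and Morse functions are `C²`-dense), carried out with Milnor's proof of the density
theorem (Milnor 1965, Thm. 2.5 / Thm. 2.7: perturb by finitely many bump × small-linear-form
terms in interior chart balls, Lemmas A and B).

In the tree's formalism (`SteinDomain.lean`: `SteinStructure W` = `(J, φ)` on a compact
`4`-manifold with boundary, Levi form `-dd^ℂφ_x(v, J_x v)`; `Morse.lean`:
`IsMorseAdapted (𝓡∂ 4) g` = Morse, `≡ 1` and regular on `∂W`, `< 1` inside; the Milnor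
iteration `Literature.Topology.FourManifolds.exists_isMorse_of_boundaryRegular` of
`CobordismMorseFunctions.lean` with its chart balls `ChartBall`, bump perturbations
`ChartBall.pert ℓ = ρ · (ℓ ∘ chart)` and thresholds; the `J`-convexity threshold
`exists_forall_levi_pos` of `SteinJConvexThreshold.lean`) this file proves:

* `exists_step_levi`, `exists_iterate_levi`, `exists_isMorse_levi_pos_of_boundaryRegular` —
  **Milnor's Thm. 2.5 with strict `J`-convexity as an extra invariant**: the step, the
  iteration and the conclusion of `CobordismMorseFunctions.lean` (`ChartBall.exists_step₂`,
  `exists_iterate₂`, `exists_isMorse_of_boundaryRegular`) re-run with the fifth threshold;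
* `SteinStructure.exists_rescale` — the affine rescaling `a(φ - max φ) + 1` of the `J`-convex
  function of a Stein structure: values in `(0, 1)` inside, `= 1` and regular on `∂W`, still
  strictly `J`-convex (`SteinStructure.reparam`, `SteinReparametrisation.lean`);
* `SteinStructure.exists_isMorseAdapted_levi_pos` — **a compact Stein domain `(W, J, φ)`
  carries a Morse function adapted to `∂W` which is strictly `J`-convex for the same `J`**.

Everything is **proved**; no definition, no named fact.  The reduction
`Literature.Geometry.Symplectic.Eliashberg1990_steinFilling_sphere_three_of_forall_exists_isMorseAdapted`
(`SteinFillingSphereMorseReduction.lean`) of Eliashberg's filling theorem asks for exactly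
this kind of adapted `J`-convex Morse function.

## References

* R. E. Gompf, *Handlebody construction of Stein surfaces*, Ann. of Math. 148 (1998), 619–693,
  Thm. 1.3 and §1. [Gompf1998]
* Ya. Eliashberg, *Topological characterization of Stein manifolds of dimension > 2*, Internat.
  J. Math. 1 (1990), 29–46, §1–§2. [Eliashberg1990Stein]
* K. Cieliebak, Ya. Eliashberg, *From Stein to Weinstein and back*, AMS Coll. Publ. 59 (2012),
  §2.1, §3.2. [CieliebakEliashberg2012]
* J. Milnor, *Lectures on the h-cobordism theorem*, Princeton (1965), §2: Thm. 2.5, Lemmas A,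
  B, proof of Thm. 2.5 (PDF p. 10). [MilnorHCobordism1965]
-/

noncomputable section

open scoped Manifold ContDiff Topology
open Set Function Filter

namespace Literature.Geometry.Symplectic

open Literature.Geometry.Kaehler Literature.Topology.FourManifolds

variable {W : Type*} [TopologicalSpace W] [T2Space W] [ChartedSpace (EuclideanHalfSpace 4) W]
  [IsManifold (𝓡∂ 4) ∞ W] {J : (x : W) → (EuclideanSpace ℝ (Fin 4) →L[ℝ] EuclideanSpace ℝ (Fin 4))}

/-! ### Milnor's Thm. 2.5 with strict `J`-convexity as an invariant -/

section Milnor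

variable [CompactSpace W]

/-- **One step of Milnor's proof of Thm. 2.5, keeping strict `J`-convexity** (the tree's
`ChartBall.exists_step₂` of `CobordismMorseFunctions.lean` with a fifth threshold,
`exists_forall_levi_pos`): given a smooth strictly `J`-convex `f` with no critical point on
the compact set `Cl`, values in `(0, 1)` in the interior and no degenerate critical point on
the compact pieces of the processed chart balls, some bump perturbation `f + ρ (ℓ ∘ φ)` in the
chart ball `κ` keeps all this and has no degenerate critical point on the compact piece of
`κ` (Lemma A in the chart of `κ`, Lemma B for the processed balls, and the five thresholds).
[cite: MilnorHCobordism1965, proof of Thm. 2.5 (PDF p. 10)] -/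
theorem exists_step_levi (hJ : PreservesSmoothFields J) (κ : ChartBall (𝓡∂ 4) W)
    (Cl : Set W) (hCl : IsCompact Cl) {f : W → ℝ} (hf : ContMDiff (𝓡∂ 4) 𝓘(ℝ, ℝ) ∞ f)
    (hreg : ∀ x ∈ Cl, ¬ IsMCriticalPt (𝓡∂ 4) f x)
    (hlt : ∀ x, (𝓡∂ 4).IsInteriorPoint x → f x < 1)
    (hpos : ∀ x, (𝓡∂ 4).IsInteriorPoint x → 0 < f x)
    (hconv : ∀ x (v : EuclideanSpace ℝ (Fin 4)), v ≠ 0 →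
      0 < -(mextDeriv (dComplex J f) x ![v, J x v]))
    (done : List (ChartBall (𝓡∂ 4) W)) (hgood : ∀ κ' ∈ done, κ'.Good f) :
    ∃ ℓ : EuclideanSpace ℝ (Fin 4) →L[ℝ] ℝ,
      (∀ x ∈ Cl, ¬ IsMCriticalPt (𝓡∂ 4) (f + κ.pert ℓ) x) ∧
      (∀ x, (𝓡∂ 4).IsInteriorPoint x → (f + κ.pert ℓ) x < 1) ∧
      (∀ x, (𝓡∂ 4).IsInteriorPoint x → 0 < (f + κ.pert ℓ) x) ∧
      (∀ x (v : EuclideanSpace ℝ (Fin 4)), v ≠ 0 →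
        0 < -(mextDeriv (dComplex J (f + κ.pert ℓ)) x ![v, J x v])) ∧
      (∀ κ' ∈ done, κ'.Good (f + κ.pert ℓ)) ∧ κ.Good (f + κ.pert ℓ) := by
  obtain ⟨δ₁, hδ₁, h₁⟩ := ChartBall.exists_forall_good_list (κ := κ) done hf hgood
  obtain ⟨δ₂, hδ₂, h₂⟩ := ChartBall.exists_forall_not_isMCriticalPt (κ := κ) Cl hCl hf hreg
  obtain ⟨δ₃, hδ₃, h₃⟩ := ChartBall.exists_forall_lt_one (κ := κ) hf hlt
  obtain ⟨δ₄, hδ₄, h₄⟩ := ChartBall.exists_forall_pos (κ := κ) hf hpos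
  obtain ⟨δ₅, hδ₅, h₅⟩ := exists_forall_levi_pos κ hJ hf hconv
  set δ := min (min (min δ₁ δ₂) (min δ₃ δ₄)) δ₅ with hδ
  have hδpos : 0 < δ := lt_min (lt_min (lt_min hδ₁ hδ₂) (lt_min hδ₃ hδ₄)) hδ₅
  -- Lemma A in the chart of `κ`
  obtain ⟨ℓ, hℓ, hA⟩ := exists_clm_norm_lt_forall_injective κ.isOpen_target κ.K_subset_target
    (κ.contDiffOn_fhat hf) hδpos
  have hℓ' : ‖ℓ‖ ≤ min (min δ₁ δ₂) (min δ₃ δ₄) := hℓ.le.trans (min_le_left _ _)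
  have hℓ₁ : ‖ℓ‖ ≤ δ₁ := hℓ'.trans ((min_le_left _ _).trans (min_le_left _ _))
  have hℓ₂ : ‖ℓ‖ ≤ δ₂ := hℓ'.trans ((min_le_left _ _).trans (min_le_right _ _))
  have hℓ₃ : ‖ℓ‖ ≤ δ₃ := hℓ'.trans ((min_le_right _ _).trans (min_le_left _ _))
  have hℓ₄ : ‖ℓ‖ ≤ δ₄ := hℓ'.trans ((min_le_right _ _).trans (min_le_right _ _))
  have hℓ₅ : ‖ℓ‖ ≤ δ₅ := hℓ.le.trans (min_le_right _ _)
  refine ⟨ℓ, h₂ ℓ hℓ₂, h₃ ℓ hℓ₃, h₄ ℓ hℓ₄, h₅ ℓ hℓ₅, h₁ ℓ hℓ₁, fun z hz h0 => ?_⟩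
  -- near `z ∈ K`, `(f + κ.pert ℓ) ∘ φ⁻¹ = f ∘ φ⁻¹ + ℓ`
  have hev : κ.fhat (f + κ.pert ℓ) =ᶠ[𝓝 z] fun w => κ.fhat f w + ℓ w := by
    filter_upwards [κ.pert_comp_symm_eventuallyEq ℓ hz] with w hw
    simp only [ChartBall.fhat_add, Pi.add_apply]
    rw [show κ.fhat (κ.pert ℓ) w = (κ.pert ℓ ∘ (extChartAt (𝓡∂ 4) κ.c).symm) w from rfl, hw]
  have hpair : pairD (κ.fhat (f + κ.pert ℓ)) z =
      (fderiv ℝ (κ.fhat f) z + ℓ, fderiv ℝ (fderiv ℝ (κ.fhat f)) z) := by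
    rw [pairD_congr_of_eventuallyEq hev]
    exact pairD_add_clm κ.isOpen_target (κ.contDiffOn_fhat hf) ℓ (κ.K_subset_target hz)
  rw [hpair] at h0 ⊢
  exact hA z hz h0

/-- **Iterating `exists_step_levi` over a list of chart balls** (Milnor 1965, proof of
Thm. 2.5: "Repeating this process `k` times"; the tree's `exists_iterate₂` with the extra
invariant): smoothness, regularity on `Cl`, `0 < · < 1` inside, strict `J`-convexity, the
values at boundary points and the absence of degenerate critical points on the processed
compact pieces are kept, and the latter is achieved for every ball of the list.
[cite: MilnorHCobordism1965, proof of Thm. 2.5 (PDF p. 10)] -/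
theorem exists_iterate_levi (hJ : PreservesSmoothFields J) (Cl : Set W) (hCl : IsCompact Cl)
    (φ₀ : W → ℝ) (todo done : List (ChartBall (𝓡∂ 4) W))
    {f : W → ℝ} (hf : ContMDiff (𝓡∂ 4) 𝓘(ℝ, ℝ) ∞ f)
    (hreg : ∀ x ∈ Cl, ¬ IsMCriticalPt (𝓡∂ 4) f x)
    (hlt : ∀ x, (𝓡∂ 4).IsInteriorPoint x → f x < 1)
    (hpos : ∀ x, (𝓡∂ 4).IsInteriorPoint x → 0 < f x)
    (hconv : ∀ x (v : EuclideanSpace ℝ (Fin 4)), v ≠ 0 →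
      0 < -(mextDeriv (dComplex J f) x ![v, J x v]))
    (hbd : ∀ x, (𝓡∂ 4).IsBoundaryPoint x → f x = φ₀ x)
    (hgood : ∀ κ ∈ done, κ.Good f) :
    ∃ g : W → ℝ, ContMDiff (𝓡∂ 4) 𝓘(ℝ, ℝ) ∞ g ∧ (∀ x ∈ Cl, ¬ IsMCriticalPt (𝓡∂ 4) g x) ∧
      (∀ x, (𝓡∂ 4).IsInteriorPoint x → g x < 1) ∧ (∀ x, (𝓡∂ 4).IsInteriorPoint x → 0 < g x) ∧
      (∀ x (v : EuclideanSpace ℝ (Fin 4)), v ≠ 0 →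
        0 < -(mextDeriv (dComplex J g) x ![v, J x v])) ∧
      (∀ x, (𝓡∂ 4).IsBoundaryPoint x → g x = φ₀ x) ∧
      ∀ κ ∈ done ++ todo, κ.Good g := by
  induction todo generalizing done f with
  | nil => exact ⟨f, hf, hreg, hlt, hpos, hconv, hbd, by simpa using hgood⟩
  | cons κ rest ih =>
    obtain ⟨ℓ, h1, h2, h2', h2'', h3, h4⟩ :=
      exists_step_levi hJ κ Cl hCl hf hreg hlt hpos hconv done hgood
    have hf' : ContMDiff (𝓡∂ 4) 𝓘(ℝ, ℝ) ∞ (f + κ.pert ℓ) := hf.add (κ.contMDiff_pert ℓ)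
    have hbd' : ∀ x, (𝓡∂ 4).IsBoundaryPoint x → (f + κ.pert ℓ) x = φ₀ x := by
      intro x hx
      have hxT : x ∉ tsupport κ.ρ := fun h =>
        ((𝓡∂ 4).isInteriorPoint_iff_not_isBoundaryPoint x).1
          (κ.isInteriorPoint_of_mem_tsupport h) hx
      show f x + κ.pert ℓ x = φ₀ x
      rw [κ.pert_eq_zero_of_notMem_tsupport hxT, add_zero, hbd x hx]
    obtain ⟨g, hg, hgreg, hglt, hgpos, hgconv, hgbd, hggood⟩ :=
      ih (done ++ [κ]) hf' h1 h2 h2' h2'' hbd' (by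
        intro κ' hκ'
        rcases List.mem_append.1 hκ' with h | h
        · exact h3 κ' h
        · simp only [List.mem_singleton] at h; subst h; exact h4)
    exact ⟨g, hg, hgreg, hglt, hgpos, hgconv, hgbd, fun κ' hκ' => hggood κ' (by simpa using hκ')⟩

/-- **Milnor 1965, Thm. 2.5, given Lemma 2.6, keeping strict `J`-convexity** (compact
`4`-manifold with boundary, `J` preserving smooth vector fields): from a smooth strictly
`J`-convex `f₀` without critical points on the boundary and with values in `(0, 1)` on the
interior one gets a strictly `J`-convex *Morse* function `f` with the same two properties and
the same values as `f₀` at every boundary point.  Proof as printed (PDF p. 10) and as in the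
tree's `exists_isMorse_of_boundaryRegular`: `df₀ ≠ 0` on the closure `Cl` of an open
`V ⊇ ∂W`; cover the compact set `W ∖ V` of interior points by finitely many chart balls;
perturb successively in each by a small generic linear form (`exists_iterate_levi`); a critical
point of the result lies in `W ∖ V`, hence in the compact piece of some ball, where the Hessian
is nondegenerate. [cite: MilnorHCobordism1965, Thm. 2.5 and its proof (PDF pp. 6, 10)] -/
theorem exists_isMorse_levi_pos_of_boundaryRegular (hJ : PreservesSmoothFields J) {f₀ : W → ℝ}
    (hf₀ : ContMDiff (𝓡∂ 4) 𝓘(ℝ, ℝ) ∞ f₀)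
    (hbd₀ : ∀ x, (𝓡∂ 4).IsBoundaryPoint x → ¬ IsMCriticalPt (𝓡∂ 4) f₀ x)
    (hint₀ : ∀ x, (𝓡∂ 4).IsInteriorPoint x → f₀ x ∈ Ioo 0 1)
    (hconv₀ : ∀ x (v : EuclideanSpace ℝ (Fin 4)), v ≠ 0 →
      0 < -(mextDeriv (dComplex J f₀) x ![v, J x v])) :
    ∃ f : W → ℝ, IsMorse (𝓡∂ 4) f ∧
      (∀ x, (𝓡∂ 4).IsBoundaryPoint x → f x = f₀ x ∧ ¬ IsMCriticalPt (𝓡∂ 4) f x) ∧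
      (∀ x, (𝓡∂ 4).IsInteriorPoint x → f x ∈ Ioo 0 1) ∧
      ∀ x (v : EuclideanSpace ℝ (Fin 4)), v ≠ 0 →
        0 < -(mextDeriv (dComplex J f) x ![v, J x v]) := by
  classical
  -- `df₀ ≠ 0` on a closed neighbourhood `Cl` of the boundary
  set V : Set W := {x | ¬ IsMCriticalPt (𝓡∂ 4) f₀ x} with hV
  have hVopen : IsOpen V := by
    have : IsClosed (criticalSet (𝓡∂ 4) f₀) := isClosed_criticalSet_of_contMDiff hf₀ (by norm_cast)
    exact this.isOpen_compl
  have hbdV : (𝓡∂ 4).boundary W ⊆ V := fun x hx => hbd₀ x hx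
  have hbdclosed : IsClosed ((𝓡∂ 4).boundary W) :=
    (𝓡∂ 4).isClosed_boundary (M := W) (n := ∞) (by simp)
  obtain ⟨N₀, hNopen, hbdN, hNV⟩ := normal_exists_closure_subset hbdclosed hVopen hbdV
  set Cl := closure N₀ with hCl
  have hClcpt : IsCompact Cl := isClosed_closure.isCompact
  have hreg₀ : ∀ x ∈ Cl, ¬ IsMCriticalPt (𝓡∂ 4) f₀ x := fun x hx => hNV hx
  -- the compact set `C = W ∖ N₀` of interior points, covered by finitely many chart balls
  set C := N₀ᶜ with hC
  have hCcpt : IsCompact C := hNopen.isClosed_compl.isCompact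
  have hCint : ∀ x ∈ C, (𝓡∂ 4).IsInteriorPoint x := fun x hx =>
    ((𝓡∂ 4).isInteriorPoint_iff_not_isBoundaryPoint x).2 fun hb => hx (hbdN hb)
  have hball : ∀ x : C, ∃ κ : ChartBall (𝓡∂ 4) W, κ.c = x.1 := by
    rintro ⟨x, hx⟩
    have hmem : extChartAt (𝓡∂ 4) x x ∈ (interiorExtChart (𝓡∂ 4) x).target :=
      (interiorExtChart (𝓡∂ 4) x).map_source ⟨mem_chart_source _ x, hCint x hx⟩
    obtain ⟨r, hr, hsub⟩ := Metric.nhds_basis_closedBall.mem_iff.1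
      ((interiorExtChart (𝓡∂ 4) x).open_target.mem_nhds hmem)
    exact ⟨⟨x, r, hr, hsub⟩, rfl⟩
  choose κ hκc using hball
  have hcover : C ⊆ ⋃ x : C, (κ x).U := fun y hy => mem_iUnion.2 ⟨⟨y, hy⟩, by
    have := (κ ⟨y, hy⟩).c_mem_U
    rwa [hκc] at this⟩
  obtain ⟨t, ht⟩ := hCcpt.elim_finite_subcover (fun x : C => (κ x).U) (fun x => (κ x).isOpen_U)
    hcover
  set balls : List (ChartBall (𝓡∂ 4) W) := t.toList.map κ with hballs
  -- iterate the step over the balls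
  obtain ⟨g, hg, hgreg, hglt, hgpos, hgconv, hgbd, hggood⟩ := exists_iterate_levi hJ Cl hClcpt f₀
    balls [] hf₀ hreg₀ (fun x hx => (hint₀ x hx).2) (fun x hx => (hint₀ x hx).1) hconv₀
    (fun x _ => rfl) (fun κ h => by simp at h)
  refine ⟨g, ⟨hg, fun x hx => ?_⟩,
    fun x hx => ⟨hgbd x hx, hgreg x (subset_closure (hbdN hx))⟩,
    fun x hx => ⟨hgpos x hx, hglt x hx⟩, hgconv⟩
  -- a critical point lies in `C`, hence in the compact piece of a ball of the cover
  have hxC : x ∈ C := fun hxN => hgreg x (subset_closure hxN) hx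
  obtain ⟨i, hit, hxi⟩ : ∃ i ∈ t, x ∈ (κ i).U := by
    have := ht hxC
    simp only [mem_iUnion, exists_prop] at this
    exact this
  set κ₀ := κ i with hκ₀
  have hκ₀mem : κ₀ ∈ balls := by
    rw [hballs, List.mem_map]; exact ⟨i, Finset.mem_toList.2 hit, rfl⟩
  have hgood : κ₀.Good g := hggood κ₀ (by simpa using hκ₀mem)
  have hxsrc : x ∈ (interiorExtChart (𝓡∂ 4) κ₀.c).source :=
    κ₀.mem_source_of_dist_le hxi.1
      (le_of_lt (lt_of_lt_of_le (Metric.mem_ball.1 hxi.2) (by linarith [κ₀.r_pos])))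
  have hxint : (𝓡∂ 4).IsInteriorPoint x := hCint x hxC
  have hd0 : fderiv ℝ (κ₀.fhat g) (extChartAt (𝓡∂ 4) κ₀.c x) = 0 :=
    (κ₀.isMCriticalPt_iff hg hxsrc).1 hx
  have hinj : Injective (fderiv ℝ (fderiv ℝ (κ₀.fhat g)) (extChartAt (𝓡∂ 4) κ₀.c x)) :=
    hgood _ (κ₀.ext_mem_K_of_mem_U hxi) hd0
  exact (nondegenerate_mhessian_iff_of_isMCriticalPt (contMDiffOn_interiorExtChart (𝓡∂ 4) κ₀.c)
    (contMDiffOn_interiorExtChart_symm (𝓡∂ 4) κ₀.c) hg hxsrc hxint hx).2 hinj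

end Milnor

/-! ### Stein domains: a `J`-convex Morse function adapted to the boundary -/

section Stein

variable [CompactSpace W]

namespace SteinStructure

/-- **The affinely rescaled `J`-convex function `f₀ = a (φ - max φ) + 1`**,
`a = 1 / (|max φ - min φ| + 1)`: it is smooth, strictly `J`-convex (for the same `J`),
`= 1` and regular at boundary points, and takes values in `(0, 1)` at interior points
(`SteinStructure.reparam` with `f(t) = a (t - max φ) + 1`, `f' = a > 0`, `f'' = 0`).
[cite: CieliebakEliashberg2012, §2] -/
theorem exists_rescale (S : SteinStructure W) :
    ∃ f₀ : W → ℝ, ContMDiff (𝓡∂ 4) 𝓘(ℝ, ℝ) ∞ f₀ ∧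
      (∀ x, (𝓡∂ 4).IsBoundaryPoint x → f₀ x = 1 ∧ ¬ IsMCriticalPt (𝓡∂ 4) f₀ x) ∧
      (∀ x, (𝓡∂ 4).IsInteriorPoint x → f₀ x ∈ Ioo 0 1) ∧
      ∀ x (v : EuclideanSpace ℝ (Fin 4)), v ≠ 0 →
        0 < -(mextDeriv (dComplex S.J f₀) x ![v, S.J x v]) := by
  set M : ℝ := sSup (range S.φ) with hM
  set m : ℝ := sInf (range S.φ) with hm
  set a : ℝ := 1 / (|M - m| + 1) with ha
  have hapos : 0 < a := by positivity
  have ha1 : a * |M - m| < 1 := by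
    rw [ha, one_div, inv_mul_lt_iff₀ (by positivity)]
    linarith
  set f : ℝ → ℝ := fun t => a * (t - M) + 1 with hfdef
  have hfd : ∀ t, HasDerivAt f a t := fun t => by
    have h := (((hasDerivAt_id t).sub_const M).const_mul a).add_const 1
    rw [mul_one] at h
    exact h
  have hderiv : deriv f = fun _ => a := funext fun t => (hfd t).deriv
  have hf : ContDiff ℝ ∞ f := by
    simp only [hfdef]
    fun_prop
  have hf' : ∀ t, 0 < deriv f t := fun t => by rw [hderiv]; exact hapos
  have hf'' : ∀ t, 0 ≤ deriv (deriv f) t := fun t => by rw [hderiv, deriv_const]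
  set S' := S.reparam hf hf' hf'' with hS'
  have hφ' : ∀ x, S'.φ x = a * (S.φ x - M) + 1 := fun x => rfl
  have hle : ∀ x, S.φ x ≤ M := fun x => le_csSup S.bddAbove_range_φ (mem_range_self x)
  have hge : ∀ x, m ≤ S.φ x := fun x =>
    csInf_le (isCompact_range S.φ_smooth.continuous).bddBelow (mem_range_self x)
  refine ⟨S'.φ, S'.φ_smooth, fun x hx => ⟨?_, fun h => S'.regular x hx h⟩, fun x hx => ?_,
    fun x v hv => S'.convex x v hv⟩
  · rw [hφ', (S.boundary_eq x).1 hx, ← hM, sub_self, mul_zero, zero_add]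
  · have hne : S.φ x ≠ M := fun h =>
      (((𝓡∂ 4).isInteriorPoint_iff_not_isBoundaryPoint x).1 hx) ((S.boundary_eq x).2 h)
    have hlt : S.φ x < M := lt_of_le_of_ne (hle x) hne
    rw [hφ']
    refine ⟨?_, by nlinarith⟩
    have h1 : a * (M - S.φ x) ≤ a * |M - m| := by
      refine mul_le_mul_of_nonneg_left ?_ hapos.le
      exact (sub_le_sub_left (hge x) M).trans (le_abs_self _)
    nlinarith

/-- **A compact Stein domain carries a strictly `J`-convex Morse function adapted to the
boundary** (Gompf 1998, Thm. 1.3: *"any such handle decomposition comes from a strictly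
plurisubharmonic function (with `∂X` a level set)"*; Eliashberg 1990, §1–§2: a generic
`J`-convex function is Morse).  Tree rendering: for `S : SteinStructure W` there is
`g : W → ℝ` with `IsMorseAdapted (𝓡∂ 4) g` (Morse, `≡ 1` and regular on `∂W`, `< 1` inside)
which is strictly `J`-convex for `S.J` at every point.  Proof: rescale `S.φ`
(`exists_rescale`) and run Milnor's density theorem with the `J`-convexity invariant
(`exists_isMorse_levi_pos_of_boundaryRegular`). [cite: Gompf1998, Thm. 1.3] -/
theorem exists_isMorseAdapted_levi_pos (S : SteinStructure W) :
    ∃ g : W → ℝ, IsMorseAdapted (𝓡∂ 4) g ∧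
      ∀ x (v : EuclideanSpace ℝ (Fin 4)), v ≠ 0 →
        0 < -(mextDeriv (dComplex S.J g) x ![v, S.J x v]) := by
  obtain ⟨f₀, hf₀, hbd₀, hint₀, hconv₀⟩ := S.exists_rescale
  obtain ⟨g, hgM, hgbd, hgint, hgconv⟩ := exists_isMorse_levi_pos_of_boundaryRegular
    S.preservesSmoothFields hf₀ (fun x hx => (hbd₀ x hx).2) hint₀ hconv₀
  refine ⟨g, ⟨hgM, fun x hx => ⟨?_, (hgbd x hx).2⟩, fun x hx => (hgint x hx).2⟩, hgconv⟩
  rw [(hgbd x hx).1, (hbd₀ x hx).1]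

end SteinStructure

end Stein

end Literature.Geometry.Symplectic

end
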